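import Mathlib
import HarnessLib
import HarnessLib.Audit
import Summits.NavierStokesRegularity.Statement
import Literature.Analysis.FluidPDE.ClassicalSolution
import Literature.Analysis.FluidPDE.LerayHopf
import Literature.Analysis.FluidPDE.SuitableWeak
import Literature.Analysis.FluidPDE.LocalTypeI
import Summits.NavierStokesRegularity.NavierStokesRegularity.Theses.TypeILiouville
import Summits.NavierStokesRegularity.NavierStokesRegularity.Theorems.TypeILiouvilleLKillsTypeI
import Literature.Analysis.FluidPDE.Seregin2023.TypeIIEulerZoom
import HarnessLib.Audit.Status.Attr

/-!
Route: EulerZoomLiouville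

# Route EulerZoomLiouville — power-gauge Euler Liouville for Seregin's zoom limits decides the
power-rate Type II conjunct of no-blow-up

It suffices to show X = X_E ∧ Z ∧ R₁ ∧ R₂ where the ATTACKED conjunct is X_E (POWER-GAUGE EULER
LIOUVILLE): for every ρ > 0, an
ancient local-energy Euler flow (u,p) on ℝ³×(−∞,0) (suitable, ν = 0, f = 0) with weak gradient H
whose gauged CKN quantities at the
origin obey Seregin's bound (3.5) with F(a) = a^ρ — sup_a [a^(2ρ)A(a) + a^ρ E(a) + a^(2ρ) D(a)] < ∞
— vanishes a.e.; Z (EULER-ZOOM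
REDUCTION, printed, support): a suitable weak NS solution with the power-gauged bound (1.7) and the
singular floor (3.1) near a point
zooms (Euler scaling v ↦ λ^(1+ρ) v(λy, λ^(2+ρ)τ)) to a NONTRIVIAL member of that class; R₁ =
TypeIOrPowerZoomable (declared RESIDUAL:
a first blow-up is Type I or power-zoomable at some point — the complement conjunct covering log /
irregular Type II gauges, strictly
weaker than stmt-0056) and R₂ = TypeIliouvilleL (declared RESIDUAL = stmt-10661, KNSS conjecture
(L), kills Type I). Lens oqh: the
printed open question is Seregin 2026 §4 («could be used for further analysis of ancient solutions
to the Euler equations»). No card.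
Lean: `PowerGaugeEulerLiouville ∧ SereginZoomReduction ∧ TypeIOrPowerZoomable ∧ TypeIliouvilleL`

## Assembly
Pure logic on top of two tree theorems (certified in glue.lean, rc 0, all four binders consumed):
TypeILiouville.Assembly_holds reduces
Clay (A) to «no maximal smooth Leray–Hopf solution from rapidly decaying data fails to extend»;
given such a failure at T,
TypeIOrPowerZoomable splits: Type I ⇒ contradiction by
Theorems.typeILiouville_typeIliouvilleLKillsTypeI_proof with TypeIliouvilleL;
power-zoomable at x₀ ⇒ SereginZoomReduction produces a nontrivial class member ⇒
PowerGaugeEulerLiouville says it is zero ⇒ contradiction.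

Rationale: WHY THIS LINE. Seregin (Seregin2023 = arXiv:2304.04045 Prop 1.2; Seregin2024; Seregin2026 =
arXiv:2606.29468 Thm 3.1) showed that a potential Type II
blow-up whose gauged Morrey quantities obey (1.7) with a power gauge f(r) = r^ρ and whose cubic
functional keeps the floor (3.1) rescales,
under the EULER scaling, to a nontrivial ancient local-energy Euler flow in the scale-invariant
class (3.5)–(3.8); for ρ > 1/2 that
class is trivial by energy (Seregin2023 §3), and arXiv:2507.08733 Thm 1.1 kills 0 < ρ ≤ 1/2 only
under an extra LPS-type
integrability v ∈ L_(s₂,l₂), 3/s₂ + (2+ρ)/l₂ = 1+ρ. The line makes the UNCONDITIONAL Euler-side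
Liouville theorem on (0,1/2] the
deciding crux (imported area: Liouville / energy-concentration theory of ancient and locally
self-similar Euler flows —
ChaeShvydkoy2013, BronziShvydkoy2015 — and Seregin2026 Prop 4.1's transport conservation law), keeps
the printed zoom as a support
port, and is honest about coverage: log-gauge and irregular Type II are NOT zoomable to a class with
a Liouville theorem (vortex rings
lie in the F ≡ 1 class), so they are a typed residual. No existing route has an Euler-side Liouville
crux: TypeIIInviscidRelaxation
bets on relaxation to symmetric Euler data (arXiv:2509.14230), TypeILiouville / RDSSLiouvilleInClass
on NS-side ancient classes;
the negatives index (NS) has no Euler-class statement. T5-CEILING = CHAE WINDOW (tenure at birth,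
critic-2 K-READ 01 (a)): E-whole CONTAINS the non-existence of locally-finite-energy (H¹_loc + local
energy inequality) self-similar Euler collapse for α = 1+ρ ∈ (1,3/2] — the window ChaeShvydkoy2013
leaves open (p.4 «it is precisely for N/p < α ≤ N/2 when this algorithm fails») and that
Constantin–Ignatova–Vicol arXiv:2602.17570 (2026) close only under the outgoing property (Thm
3.8/3.10; γ = 1/(2+ρ) ∈ [2/5,1/2)); a seat on E-whole is a seat on that problem, so progress is
metered on the in-window rungs C1–C3 below, not on E-whole. WHAT THIS IS NOT (K-READ 01 (c)): not
N0-whole — the residual R = TypeIOrPowerZoomable leaves OUT (i) logarithmic / slowly-varying /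
irregular gauges (Seregin2026 (1.5)–(1.6), f = ln^(−γ); vortex rings sit in the F ≡ 1 class) and
(ii) power-rate blow-ups failing (1.7) or the floor (3.1) at every point; it is complementary to the
banked N0⁻-RateLadder (§B candidates 2/4) only at the persistent end, amplitude exponents m =
(1+ρ)/(2+ρ) ∈ (1/2,3/5].

RANKED CRUXES. #2 PowerGaugeEulerLiouville (crux) — for every ρ > 0: a suitable (ν = 0, f = 0) weak
Euler solution (u,p) on the slab ℝ³×(−∞,0) with weak spatial gradient H and sup over a > 0 of
a^(2ρ)·cknA(a;0) + a^ρ·cknE(a;0;H) + a^(2ρ)·cknD(a;0;p) ≤ c < ∞ is zero a.e. on t < 0 (Seregin's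
class (3.5)–(3.8) with F(a) = a^ρ; ρ > 1/2 is the proved rung). [difficulty: open-problem] (why it
might fail: exactly α-self-similar Euler collapse profiles (α = 1+ρ ∈ (1,3/2], tails |V| ~ |z|^(-α))
satisfy all three gauges at order a^0; their non-existence is the OPEN Chae–Shvydkoy window 3/p < α
≤ 3/2, and an Euler-inequality (Scheffer-type) member would refute it as typed.) [Seregin2026,
arXiv:2507.08733, Seregin2023, ChaeShvydkoy2013, BronziShvydkoy2015]
#3 TypeIOrPowerZoomable (crux) — DECLARED RESIDUAL (complement conjunct, weaker than stmt-0056). At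
a first blow-up time T of a maximal smooth Leray–Hopf solution from a rapidly decaying datum, either
the Type I rate holds, or at some x₀ the viscosity-normalised solution s ↦ ν⁻¹u(s/ν,·), with an
admissible local pressure q and weak gradient G in a parabolic ball at (νT, x₀), obeys Seregin's
power-gauged bound (1.7) with f(r) = r^ρ for some ρ ∈ (0,1/2] and keeps the singular floor (3.1) at
s = l = 3 (r^(2ρ−2) ∫ over B(x₀,r)×(νT−r^(2+ρ), νT) of |v|³ ≥ ε₀ along r ↓ 0). [difficulty:
open-problem] (why it might fail: a genuine Type II blow-up with a logarithmic or irregular gauge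
(Seregin2026 (1.5)–(1.6), f = ln^(-γ)) or with gauged quantities unbounded for every power is
consistent with everything known; this residual is coverage, not mechanism.) [Seregin2026,
Seregin2024, KochNadirashviliSereginSverak2009]
#4 TypeIliouvilleL (crux) — DECLARED RESIDUAL, shared verbatim with TypeILiouville.TypeIliouvilleL
(stmt-NavierStokesRegularity-10661): KNSS Liouville conjecture (L) — a bounded ancient mild NS
solution (ν = 1) with measurable slices is a.e. constant on each slice. [difficulty: open-problem]
(why it might fail: conjecture (L) is open beyond the axisymmetric cases (KNSS 2009 Thms 1.1–1.3); a
nontrivial bounded ancient 3-D mild solution may exist.) [KochNadirashviliSereginSverak2009,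
AlbrittonBarker2019]
#9 SereginZoomReduction (support) — port of the printed Euler-zoom theorem (Seregin2026 Thm 3.1 at
(s,l,κ,η) = (3,3,2,0), f(r) = r^ρ, 0 < ρ ≤ 1/2 so that (3.3) holds with κ₁ = ρ(17/20 − ρ) > 0;
Seregin2023 Prop 1.2): a suitable weak NS solution (ν = 1) in a parabolic ball with weak gradient G,
the power-gauged bound (1.7) and the floor (3.1) yields, by Euler scaling and compactness, a member
(u,p,H,c) of the class of PowerGaugeEulerLiouville that is NOT a.e. zero. [difficulty: L]
[Seregin2026, Seregin2023, Seregin2024, CaffarelliKohnNirenberg1982]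

TWO-LAYER PLAN. Foreseen split of the deciding crux (registered birth skeleton
bc/PowerGaugeEulerLiouville_birth.lean, rc 0, sorries = 3 stubs):
PowerGaugeEulerLiouville ⇐ LargeRho (ρ > 1/2, PROVED as rung: bc/PowerGaugeEulerLiouville_rung.lean)
→ BackwardVanishing (E-gauge ⇒
slices vanish on fixed balls along density-one times τ → −∞) → NoCollapseFromZero (0 < ρ ≤ 1/2:
backward-vanishing class member is 0)
→ PowerGaugeEulerLiouville. SereginZoomReduction ⇐ GaugedCompactness (CKN/Lin ε-regularity
bookkeeping under (1.7)) → FloorSurvives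
((3.4): the zoom keeps the scale-invariant floor) → EulerLimitIdentity (ν λ^(1−α) Δ-term → 0, local
energy inequality passes to the limit). FIRST IN-WINDOW RUNG (tenure at birth, K-READ 01 (b);
plan-only, typed and farm-checked rc 0 in the evidence file
PowerGaugeEulerLiouville_rungC_window.lean, namespace …Cruxes.PowerGaugeEulerLiouville.RungC, each
signature a kernel-checked sub-case of the crux): C1 `Sig.rungC1_selfSimilar` — for 0 < ρ ≤ 1/2
every EXACTLY SELF-SIMILAR member (u = (−τ)^(−(1+ρ)/(2+ρ)) V((−τ)^(−1/(2+ρ)) y), p likewise)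
vanishes = Chae's open window without decay hypotheses = CIV 2026's question without the outgoing
property; FIRST PROVER TARGET: the endpoint ρ = 1/2 (energy-conserving scaling α = 3/2: port
ChaeShvydkoy2013 Thm 3.1 and replace its lower power bound by the D-gauge a^(2ρ)D(a) ≤ c); printed
sub-cases to port as helpers: ChaeShvydkoy2013 Thm 4.1 (vorticity profile in L^q, q < 3/(2+ρ)),
BronziShvydkoy2015 Thm 1.1 (dichotomy), arXiv:2602.17570 Thm 3.8/Prop 3.9/Thm 3.10 (outgoing ⇒ none
in the window) and §4 (axisymmetric profiles: swirl at a stagnation point ⇒ γ = 1/2; C¹ with on-axis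
stagnation set ⇒ γ ≥ 1/2). C2 `Sig.rungC2_dss` — discretely self-similar (log-periodic) members
vanish (⊇ C1; no print in the window). C3 `Sig.rungC3_axisymNoSwirl` — axisymmetric no-swirl members
vanish (Euler-side ancient class, NOT a costume of stmt-1964; Elgindi's C^(1,α) axisymmetric
no-swirl self-similar blow-up has length exponent > 1, i.e. ρ < 0, outside the class). Rungs A (ρ >
1/2, energy-gaining, PROVED) and B (steady members: large-scale arithmetic of the E-weight,
Z₀a^(1+ρ) → ∞; steady-with-steady-gradient stratum LANDED by ns-typeII-p3, p470452 + p470725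
Theorems/TypeILiouvilleTypeIliouvilleNoTypeIIPowerGaugeSteady.lean; BC5 WITNESS OF RECORD = the tree
theorem
Summit.NavierStokesRegularity.NavierStokesRegularity.Theorems.TypeIliouvilleNoTypeII.PowerGaugeSteady.powerGauge_steady_ae_eq_zero_of_sum,
the steady-with-steady-gradient stratum of E in exactly the Sketch binder shape) are FLOOR /
ARITHMETIC labels — they do not exercise the local-energy-flux lever inside the window (K-READ 01
§K5); C1–C3 do.

KILL CRITERIA. A nontrivial member of the power-gauged Euler class for some ρ ∈ (0,1/2] (e.g. an
α-self-similar local-energy Euler collapse profile with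
α = 1+ρ, or a Scheffer-type Euler-inequality construction upgraded to the Euler identity) refutes
PowerGaugeEulerLiouville ⇒ close
`refuted:PowerGaugeEulerLiouville` (the zoom support and the residual survive as banked context for
a narrower class). A Type II blow-up
with non-power gauge refutes only the residual TypeIOrPowerZoomable ⇒ ¬(A) territory, route moot.
TypeIliouvilleL refuted ⇒ shared
fate with TypeILiouville (pivot the Type I side to TypeICertificateLadder's certificates). NoTypeII
(stmt-0056) or NoBlowup proved
elsewhere moots the route; PowerGaugeEulerLiouville proved alone is a publishable Euler Liouville
theorem (Seregin's open question). KILL TEST SHARPENED (tenure, T2 r1 § Flags 3): within the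
self-similar sub-family (rung C1; CIV length exponent γ = 1/(2+ρ), window ρ ∈ (0,1/2] ⟺ γ ∈
[2/5,1/2)) a refuting C² profile must be NON-OUTGOING in the sense of ConstantinIgnatovaVicol2026
Def 3.7 or have Ω non-analytic at a nodal point of V = γy + U — CIV Thm 3.8 (Ω(y_*) ≠ 0 at a nodal
point + local outgoing ⇒ γ ≥ 1/2 + c_*) and Thm 3.10 (outgoing + Ω real-analytic at all nodal points
⇒ γ ≥ 1/2) exclude outgoing candidates from the window; axisymmetric candidates are further
constrained by CIV Thm 4.3 (outgoing near the axis nodes ⇒ γ ≥ 1/2 + c_*) and Thm 4.4 (a meridional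
fixed point with nonzero swirl forces γ = 1/2 exactly, i.e. ρ = 0, outside the window); Elgindi2025
isolates the outgoing property as one of the two structural hypotheses under which the profile
vorticity equation is solvable, so the live refutation target is a recirculating (non-outgoing)
finite-energy profile of Hou–WLGZB23 type; ChaeWolf2017 (energy concentration / Type I for Euler)
bounds what an energy-concentrating Euler blow-up member can look like. These constraints apply to
the refuter's witness, not to E's statement.

NOT DECOMPOSED YET. The compactness/ε-regularity constants of the zoom port (layer-2 children of
SereginZoomReduction); the flux-control input for
0 < ρ ≤ 18/31 inside NoCollapseFromZero (gauge-only bookkeeping reaches only ρ > 18/31 — NOTES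
computation); the pressure
normalisation of the Euler limit (p ∈ L^(3/2)_loc with the D-gauge, no harmonic part); any
axisymmetric specialisation (would be a
costume of stmt-1964 — deliberately not filed). (That remark concerns NS-side axisymmetric
restrictions of the residual; the Euler-side rung C3 above restricts the crux E, whose members need
not arise from NS data, and neither implies nor follows from stmt-1964.)

CHEAPEST FALSIFIER. Compute the three gauge exponents of ONE explicit candidate member: Elgindi's
C^(1,α) self-similar Euler blow-up profile (Ann. Math. 2021)
and the homogeneous stationary/self-similar Euler solutions of ChaeShvydkoy2013 §1 — if any has ∇u ∈
L²_loc, the local energy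
inequality and bounded a^(2ρ)A + a^ρ E + a^(2ρ)D for some ρ ∈ (0,1/2], the deciding crux is false as
typed. Run in-seat for the
generic α-self-similar ansatz: all three gauges are O(1) (consistent, no kill); the ansatz's
existence is the open window itself.
In-Lean: BC7 probe 4/4 CLEAN; rung ρ > 1/2 proved (bc/PowerGaugeEulerLiouville_rung.lean,
sorry-free).

NUMBERS. Gauge/scaling: α = 1+ρ (velocity), time exponent 2+ρ, floor exponent 2−2ρ (scale-invariant,
Seregin2026 (3.4)); admissibility (3.3) at
s = l = 3: κ₁ = ρ(17/20 − ρ) > 0 ⇔ 0 < ρ < 17/20. Known Liouville regimes: ρ > 1/2 (energy,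
Seregin2023 §3); 0 < ρ ≤ 1/2 under
v ∈ L_(s₂,l₂), 3/s₂ + (2+ρ)/l₂ = 1+ρ (arXiv:2507.08733 Thm 1.1); self-similar profiles v ∈ L^p: −1 <
α ≤ 3/p or α > 3/2
(ChaeShvydkoy2013 Thm 3.2); energy equipartition dimension 3−2α for 0 < α < 3/2 (BronziShvydkoy2015
Thm 1.1). Gauge-only flux
bookkeeping ceiling: ρ > 18/31 (NOTES). Items at open: 5 (4 statements + the Assembly item, which is
exactly the type of `closes`).

DEFINITION REQUESTS. None: IsSuitableWeakSolutionOn / InBall, HasWeakSpatialGradientOn, cknA / cknE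
/ cknD, slab, parabolicCylinderOpens, IsMaximalSmoothSolution,
IsLerayHopfOn, HasRapidSpatialDecay, IsTypeIBlowup, IsBoundedAncientMildSolution all exist in
Literature.Analysis.FluidPDE. Cite fact wanted
(not filed this cycle — no ledger writes under the birth flag): «fact: Seregin2026 Thm 3.1
(Euler-zoom limit in class (3.5)–(3.8))», bib
entry Seregin2025 (arXiv:2507.08733) prepared as Seregin2025.bib.

Novelty: Searches (2026-08-26): lit search --hybrid "Type II blowup Navier-Stokes Euler scaling Seregin"
(held: paper-arxiv-2606.29468, 2304.04045, 2507.08733); lit citing arxiv:2304.04045 (4: 2507.03881,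
2507.08733, 2510.25448, 2402.13229); lit search "locally self-similar Euler Liouville energy" (held:
paper-arxiv-1201.6009, 1310.8611); lit vsearch «Liouville theorem for ancient weak Euler solutions
with local energy inequality and Morrey-type bounds» (textbooks only); lit galaxy search
"self-similar Euler|Type II blowup|ancient Euler" --star all (0 relevant) and "locally
self-similar|Euler scaling|potential Type II" --star pdf (0 relevant); lean search 'Seregin2023'
(tree: TypeIIEulerZoom.lean HasScaledLocalEnergyBound lemmas); ledger negatives --problem
NavierStokesRegularity (no Euler-class statement).
Nearest prior art found: arXiv:2507.08733 (Seregin 2025) Thm 1.1 — excludes the power scenario for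
1/2 ≤ m < 1 under the extra LPS-type hypothesis v ∈ L_(s₂,l₂)(Q); Seregin2026 Thm 3.1 / Prop 4.1
(zoom + axisymmetric conservation law, no Liouville); route TypeIIInviscidRelaxation
(relaxation-to-symmetric-Euler rigidity, arXiv:2509.14230 — different object).
Delta: the Euler-side Liouville theorem in the power-gauged class WITHOUT the LPS hypothesis becomes
the typed deciding crux (with a proved ρ > 1/2 rung and a backward-vanishing skeleton), the printed
zoom a support, and the uncovered Type II gauges an explicit residual — a combination absent from
the searched literature and fro  [refs: 2304.04045, 2507.08733, 2509.14230, paper-arxiv-2606.29468, arxiv:2304.04045, paper-arxiv-1201.6009, Seregin2023, Seregin2026]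

Barriers (technique_class: euler-scaling-zoom, ancient-euler-liouville, gauged-morrey): - technique_class: euler-scaling-zoom, ancient-euler-liouville, gauged-morrey
- Literature.Barriers.NavierStokesRegularity.EnergySupercriticality: the deciding crux is
scale-INVARIANT under the Euler scaling (gauges and conclusion), so no supercritical quantity is
asked to control a critical one inside it; the supercritical gap is crossed only by the printed zoom
(support). It does not evade «no coercive critical quantity» in general; the bet is that the E-gauge
(dissipation starved along the zoom) plus exact Euler transport structure is the extra input.
- Literature.Barriers.NavierStokesRegularity.TaoAveragedBlowup: the mechanism uses the exact local
energy identity with the physical pressure and pointwise transport laws of genuine Euler flows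
(Seregin2026 Prop 4.1), which an averaged bilinear form does not carry; outside the
averaged-equation class.
- Literature.Barriers.NavierStokesRegularity.NavierStokesInequalitySingularSolution:
Scheffer/Ożański singular flows solve only the INEQUALITY; class membership requires the
distributional Euler identity; conceded adjacency — an Euler-inequality construction inside the
gauged class is the named falsifier.
- Literature.Barriers.NavierStokesRegularity.BuckmasterVicolNonuniqueness: convex-integration
Euler/NS solutions live below ∇u ∈ L²_loc and carry no local energy inequality; the class demands
both (E-gauge), so known wild solutions are not members; the bet is that no scheme reaches gauged
H¹.
- Negatives index: no refuted state

sub-problem: NavierStokesRegularity · status: open · opened operator:999:2688362 2026-08-26T22:34:43Z · rev 3 · ledger route-NavierStokesRegularity-EulerZoomLiouville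
GENERATED by the gate from the ledger (D-0016/17). Provers cite these decls: `theorem foo : Summit.NavierStokesRegularity.NavierStokesRegularity.Theses.EulerZoomLiouville.<Decl> := …` in Summits/NavierStokesRegularity/NavierStokesRegularity/Theorems/<Name>.lean.
-/

namespace Summit.NavierStokesRegularity.NavierStokesRegularity.Theses.EulerZoomLiouville

open scoped BigOperators Topology Manifold Classical MeasureTheory ProbabilityTheory Matrix InnerProductSpace ComplexConjugate ContinuousMap
open Filter Set Function TopologicalSpace MeasureTheory

attribute [summit_statement] _root_.NavierStokesRegularity

open Literature.NS

/-- item stmt-NavierStokesRegularity-19832 · crux · rank 2 · open · by operator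
why it might fail: exactly α-self-similar Euler collapse profiles (α = 1+ρ ∈ (1,3/2], tails |V| ~ |z|^(-α)) satisfy all three gauges at order a^0; their non-existence is the OPEN Chae–Shvydkoy window 3/p < α ≤ 3/2, and an Euler-inequality (Scheffer-type) member would refute it as typed.
sources: Seregin2026, arXiv:2507.08733, Seregin2023, ChaeShvydkoy2013, BronziShvydkoy2015, ConstantinIgnatovaVicol2026
[crux] for every ρ > 0: a suitable (ν = 0, f = 0) weak Euler solution (u,p) on the slab ℝ³×(−∞,0)
with weak spatial gradient H and sup over a > 0 of a^(2ρ)·cknA(a;0) + a^ρ·cknE(a;0;H) +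
a^(2ρ)·cknD(a;0;p) ≤ c < ∞ is zero a.e. on t < 0 (Seregin's class (3.5)–(3.8) with F(a) = a^ρ; ρ >
1/2 is the proved rung). [difficulty: open-problem] -/
@[route_item "route-NavierStokesRegularity-EulerZoomLiouville", crux (bottleneck := idea) (experiment := "instrument: 6 ⟨25311⟩ IDEA-NEEDED (stub ≡ crux `HemisphereLiouvilleE3`; 14 LEAD gens, 0 movement) · W7 ⟨24077⟩ R0 IDEA-NEEDED (all transport proved; ce…") (source := "director HOURLY-NS l.1327, 2026-09-01")]
def PowerGaugeEulerLiouville : Prop :=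
  ∀ ρ : ℝ, 0 < ρ → ∀ (u : ℝ → EuclideanSpace ℝ (Fin 3) → EuclideanSpace ℝ (Fin 3)) (p : ℝ → EuclideanSpace ℝ (Fin 3) → ℝ) (H : ℝ → EuclideanSpace ℝ (Fin 3) → EuclideanSpace ℝ (Fin 3) →L[ℝ] EuclideanSpace ℝ (Fin 3)) (c : NNReal), Literature.Analysis.FluidPDE.IsSuitableWeakSolutionOn (Literature.Analysis.FluidPDE.slab (EuclideanSpace ℝ (Fin 3)) (Set.Iio 0) isOpen_Iio) 0 0 u p → Literature.Analysis.FluidPDE.HasWeakSpatialGradientOn (Literature.Analysis.FluidPDE.slab (EuclideanSpace ℝ (Fin 3)) (Set.Iio 0) isOpen_Iio) u H → (∀ a : ℝ, 0 < a → ENNReal.ofReal (a ^ (2 * ρ)) * Literature.Analysis.FluidPDE.cknA a (0 : ℝ × EuclideanSpace ℝ (Fin 3)) u + ENNReal.ofReal (a ^ ρ) * Literature.Analysis.FluidPDE.cknE a (0 : ℝ × EuclideanSpace ℝ (Fin 3)) H + ENNReal.ofReal (a ^ (2 * ρ)) * Literature.Analysis.FluidPDE.cknD a (0 : ℝ ×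 EuclideanSpace ℝ (Fin 3)) p ≤ (c : ENNReal)) → Function.uncurry u =ᵐ[MeasureTheory.volume.restrict (Set.Iio (0 : ℝ) ×ˢ (Set.univ : Set (EuclideanSpace ℝ (Fin 3))))] 0

/-- item stmt-NavierStokesRegularity-19833 · crux · rank 3 · open · by operator
why it might fail: a genuine Type II blow-up with a logarithmic or irregular gauge (Seregin2026 (1.5)–(1.6), f = ln^(-γ)) or with gauged quantities unbounded for every power is consistent with everything known; this residual is coverage, not mechanism.
sources: Seregin2026, Seregin2024, KochNadirashviliSereginSverak2009
[crux] DECLARED RESIDUAL (complement conjunct, weaker than stmt-0056). At a first blow-up time T of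
a maximal smooth Leray–Hopf solution from a rapidly decaying datum, either the Type I rate holds, or
at some x₀ the viscosity-normalised solution s ↦ ν⁻¹u(s/ν,·), with an admissible local pressure q
and weak gradient G in a parabolic ball at (νT, x₀), obeys Seregin's power-gauged bound (1.7) with
f(r) = r^ρ for some ρ ∈ (0,1/2] and keeps the singular floor (3.1) at s = l = 3 (r^(2ρ−2) ∫ over
B(x₀,r)×(νT−r^(2+ρ), νT) of |v|³ ≥ ε₀ along r ↓ 0). [difficulty: open-problem] -/
@[route_item "route-NavierStokesRegularity-EulerZoomLiouville", crux]
def TypeIOrPowerZoomable : Prop :=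
  ∀ (ν T : ℝ), 0 < ν → 0 < T → ∀ (u : ℝ → EuclideanSpace ℝ (Fin 3) → EuclideanSpace ℝ (Fin 3)) (p : ℝ → EuclideanSpace ℝ (Fin 3) → ℝ), Literature.Analysis.FluidPDE.IsMaximalSmoothSolution ν 0 u p T → Literature.Analysis.FluidPDE.IsLerayHopfOn T ν 0 (u 0) u → Literature.Analysis.FluidPDE.HasRapidSpatialDecay (u 0) → Literature.Analysis.FluidPDE.IsTypeIBlowup u T ∨ ∃ (x₀ : EuclideanSpace ℝ (Fin 3)) (q : ℝ → EuclideanSpace ℝ (Fin 3) → ℝ) (G : ℝ → EuclideanSpace ℝ (Fin 3) → EuclideanSpace ℝ (Fin 3) →L[ℝ] EuclideanSpace ℝ (Fin 3)) (r₀ ρ : ℝ), 0 < ρ ∧ ρ ≤ 1 / 2 ∧ 0 < r₀ ∧ Literature.Analysis.FluidPDE.IsSuitableWeakSolutionInBall r₀ (ν * T, x₀) (fun s y => ν⁻¹ • u (s / ν) y) q ∧ Literature.Analysis.FluidPDE.HasWeakSpatialGradientOn (Literature.Analysis.FluidPDE.parabolicCylinderOpens r₀ (ν * T, x₀)) (fun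 s y => ν⁻¹ • u (s / ν) y) G ∧ (∃ M : NNReal, ∀ r ∈ Set.Ioc 0 r₀, ENNReal.ofReal (r ^ (2 * ρ)) * Literature.Analysis.FluidPDE.cknA r (ν * T, x₀) (fun s y => ν⁻¹ • u (s / ν) y) + ENNReal.ofReal (r ^ ρ) * Literature.Analysis.FluidPDE.cknE r (ν * T, x₀) G + ENNReal.ofReal (r ^ (2 * ρ)) * Literature.Analysis.FluidPDE.cknD r (ν * T, x₀) q ≤ (M : ENNReal)) ∧ (∃ ε₀ : ℝ, 0 < ε₀ ∧ ∀ δ : ℝ, 0 < δ → ∃ r ∈ Set.Ioo 0 δ, ENNReal.ofReal ε₀ ≤ ENNReal.ofReal (r ^ (2 * ρ - 2)) * ∫⁻ w in Set.Ioo (ν * T - r ^ (2 + ρ)) (ν * T) ×ˢ Metric.ball x₀ r, ‖(ν⁻¹ • u (w.1 / ν) w.2)‖ₑ ^ (3 : ℕ))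

/-- item stmt-NavierStokesRegularity-10661 · crux · rank 4 · open · by planner
why it might fail: conjecture (L) is open beyond the axisymmetric cases (KNSS 2009 Thms 1.1–1.3); a nontrivial bounded ancient 3-D mild solution may exist.
sources: KochNadirashviliSereginSverak2009, AlbrittonBarker2019
[crux] KNSS Liouville conjecture (L), verbatim: every bounded ancient mild solution u of
Navier–Stokes (ν = 1) on ℝ³ × (−∞,0) (duality-form class
`Literature.Analysis.FluidPDE.IsBoundedAncientMildSolution 1 u`) with a.e.-strongly measurable
slices is spatially constant on every slice t < 0 (u t = b a.e.). DEFINITIONALLY EQUAL to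
`Literature.Analysis.FluidPDE.LiouvilleConjectureNS` (`Iff.rfl`, checked); inlined at rev 2
(route-repair) so that the open conjecture is carried by the route as this ITEM (to be proved or
refuted) and not as a cite-only Literature leaf of the cone, which had made the route unstaffable. A
proof or refutation here settles stmt-0057 (`LiouvilleConjectureNS`, shared with CoreLogGas /
VorticityPace) by `Iff.rfl`, and conversely. Open (KNSS2009 §1: 'completely open … even in the
steady-state case'; Seregin 2014 lecture notes p.113); known cases: 2-D (KNSS Thm 5.1), axisymmetric
no swirl (Thm 5.2 = `knss_axisymmetric_no_swirl`), r|u| ≤ C (Thm 5.3 = `knss_bound_C_over_r`),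
LeiZhang2011; consequences already in tree: `LiouvilleConjectureNS.slices_ae_eq_zero_of_typeIBound`,
`LiouvilleConjectureNS.not_nontrivialMildAncientTypeIExists_measurable` ((L) + Type I bound ⇒ -/
@[route_item "route-NavierStokesRegularity-EulerZoomLiouville", crux]
def TypeIliouvilleL : Prop :=
  ∀ u : ℝ → EuclideanSpace ℝ (Fin 3) → EuclideanSpace ℝ (Fin 3), Literature.Analysis.FluidPDE.IsBoundedAncientMildSolution 1 u → (∀ t < 0, MeasureTheory.AEStronglyMeasurable (u t) MeasureTheory.volume) → ∀ t < 0, ∃ b : EuclideanSpace ℝ (Fin 3), u t =ᵐ[MeasureTheory.volume] fun _ => b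

/-- item stmt-NavierStokesRegularity-19834 · support · rank 9 · closed · proved by Summit.NavierStokesRegularity.NavierStokesRegularity.Theorems.SereginZoomReduction.sereginZoomReduction_proof (prover) · by operator
sources: Seregin2026, Seregin2023, Seregin2024, CaffarelliKohnNirenberg1982
[support] port of the printed Euler-zoom theorem (Seregin2026 Thm 3.1 at (s,l,κ,η) = (3,3,2,0), f(r)
= r^ρ, 0 < ρ ≤ 1/2 so that (3.3) holds with κ₁ = ρ(17/20 − ρ) > 0; Seregin2023 Prop 1.2): a suitable
weak NS solution (ν = 1) in a parabolic ball with weak gradient G, the power-gauged bound (1.7) and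
the floor (3.1) yields, by Euler scaling and compactness, a member (u,p,H,c) of the class of
PowerGaugeEulerLiouville that is NOT a.e. zero. [difficulty: L] -/
@[route_item "route-NavierStokesRegularity-EulerZoomLiouville", crux]
def SereginZoomReduction : Prop :=
  ∀ ρ : ℝ, 0 < ρ → ρ ≤ 1 / 2 → ∀ (r₀ : ℝ) (z₀ : ℝ × EuclideanSpace ℝ (Fin 3)) (v : ℝ → EuclideanSpace ℝ (Fin 3) → EuclideanSpace ℝ (Fin 3)) (q : ℝ → EuclideanSpace ℝ (Fin 3) → ℝ) (G : ℝ → EuclideanSpace ℝ (Fin 3) → EuclideanSpace ℝ (Fin 3) →L[ℝ] EuclideanSpace ℝ (Fin 3)), 0 < r₀ → Literature.Analysis.FluidPDE.IsSuitableWeakSolutionInBall r₀ z₀ v q → Literature.Analysis.FluidPDE.HasWeakSpatialGradientOn (Literature.Analysis.FluidPDE.parabolicCylinderOpens r₀ z₀) v G → (∃ M : NNReal, ∀ r ∈ Set.Ioc 0 r₀, ENNReal.ofReal (r ^ (2 * ρ)) * Literature.Analysis.FluidPDE.cknA r z₀ v + ENNReal.ofReal (r ^ ρ) * Literature.Analysis.FluidPDE.cknE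 r z₀ G + ENNReal.ofReal (r ^ (2 * ρ)) * Literature.Analysis.FluidPDE.cknD r z₀ q ≤ (M : ENNReal)) → (∃ ε₀ : ℝ, 0 < ε₀ ∧ ∀ δ : ℝ, 0 < δ → ∃ r ∈ Set.Ioo 0 δ, ENNReal.ofReal ε₀ ≤ ENNReal.ofReal (r ^ (2 * ρ - 2)) * ∫⁻ w in Set.Ioo (z₀.1 - r ^ (2 + ρ)) z₀.1 ×ˢ Metric.ball z₀.2 r, ‖v w.1 w.2‖ₑ ^ (3 : ℕ)) → ∃ (u : ℝ → EuclideanSpace ℝ (Fin 3) → EuclideanSpace ℝ (Fin 3)) (p : ℝ → EuclideanSpace ℝ (Fin 3) → ℝ) (H : ℝ → EuclideanSpace ℝ (Fin 3) → EuclideanSpace ℝ (Fin 3) →L[ℝ] EuclideanSpace ℝ (Fin 3)) (c : NNReal), Literature.Analysis.FluidPDE.IsSuitableWeakSolutionOn (Literature.Analysis.FluidPDE.slab (EuclideanSpace ℝ (Fin 3)) (Set.Iio 0) isOpen_Iio) 0 0 u p ∧ Literature.Analysis.FluidPDE.HasWeakSpatialGradientOn (Literature.Analysis.FluidPDE.slab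 (EuclideanSpace ℝ (Fin 3)) (Set.Iio 0) isOpen_Iio) u H ∧ (∀ a : ℝ, 0 < a → ENNReal.ofReal (a ^ (2 * ρ)) * Literature.Analysis.FluidPDE.cknA a (0 : ℝ × EuclideanSpace ℝ (Fin 3)) u + ENNReal.ofReal (a ^ ρ) * Literature.Analysis.FluidPDE.cknE a (0 : ℝ × EuclideanSpace ℝ (Fin 3)) H + ENNReal.ofReal (a ^ (2 * ρ)) * Literature.Analysis.FluidPDE.cknD a (0 : ℝ × EuclideanSpace ℝ (Fin 3)) p ≤ (c : ENNReal)) ∧ ¬ (Function.uncurry u =ᵐ[MeasureTheory.volume.restrict (Set.Iio (0 : ℝ) ×ˢ (Set.univ : Set (EuclideanSpace ℝ (Fin 3))))] 0)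

-- `SereginZoomReduction` holds: proved by `Summit.NavierStokesRegularity.NavierStokesRegularity.Theorems.SereginZoomReduction.sereginZoomReduction_proof` (its module imports this route file, so no `_holds` link can be stated here).

/-- item stmt-NavierStokesRegularity-19835 · assembly · rank 1 · closed · proved by Summit.NavierStokesRegularity.NavierStokesRegularity.Theorems.EulerZoomLiouvilleAssembly.assembly_proof (prover) · by operator
sources: Seregin2026, KochNadirashviliSereginSverak2009
[assembly] PowerGaugeEulerLiouville → SereginZoomReduction → TypeIOrPowerZoomable → TypeIliouvilleL
→ NavierStokesRegularity (exactly the type of the deciding theorem `closes` in glue.lean). -/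
@[route_item "route-NavierStokesRegularity-EulerZoomLiouville"]
def Assembly : Prop :=
  PowerGaugeEulerLiouville → SereginZoomReduction → TypeIOrPowerZoomable → TypeIliouvilleL → NavierStokesRegularity

-- `Assembly` holds: proved by `Summit.NavierStokesRegularity.NavierStokesRegularity.Theorems.EulerZoomLiouvilleAssembly.assembly_proof` (its module imports this route file, so no `_holds` link can be stated here).

/-! D-0027 §2.1 — DECIDING THEOREM (planner-authored via `route open/edit --closes-file`; by operator:999:2688362 2026-08-26T22:34:43Z):
its hypotheses are this route's items and its conclusion the sub-problem Statement (glue_lint), and it elaborates with this file. -/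

@[closes "route-NavierStokesRegularity-EulerZoomLiouville"] theorem closes (hEL : PowerGaugeEulerLiouville) (hZoom : SereginZoomReduction)
    (hCov : TypeIOrPowerZoomable) (hL : TypeIliouvilleL) : _root_.NavierStokesRegularity := by
  apply _root_.Summit.NavierStokesRegularity.NavierStokesRegularity.Theses.TypeILiouville.Assembly_holds
  intro ν T hν hT u p hcl hLH hdec
  by_contra hext
  have hmax : Literature.Analysis.FluidPDE.IsMaximalSmoothSolution ν 0 u p T := ⟨hcl, hext⟩
  rcases hCov ν T hν hT u p hmax hLH hdec with hI | ⟨x₀, q, G, r₀, ρ, hρ, hρ', hr₀, hsw, hG, hM, hfloor⟩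
  · exact _root_.Summit.NavierStokesRegularity.NavierStokesRegularity.Theorems.typeILiouville_typeIliouvilleLKillsTypeI_proof
      hL ν T hν hT u p hmax hLH hdec hI
  · obtain ⟨U, P, H, c, hU, hH, hclass, hne⟩ :=
      hZoom ρ hρ hρ' r₀ (ν * T, x₀) (fun s y => ν⁻¹ • u (s / ν) y) q G hr₀ hsw hG hM hfloor
    exact hne (hEL ρ hρ U P H c hU hH hclass)

end Summit.NavierStokesRegularity.NavierStokesRegularity.Theses.EulerZoomLiouville
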